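import Summits.ResolutionOfSingularities.ResolutionOfSingularities.Theorems.HilbertSamuelEliminationSigmaMaxModificationsCorridor3RegimeGlue
import Summits.ResolutionOfSingularities.ResolutionOfSingularities.Theorems.HilbertSamuelEliminationSigmaMaxModificationsCorridor3TameWildStubIsolatedNu3
import HarnessLib

/-!
# `SigmaMaxModificationsCorridor3` (stmt-19249) / `SigmaMaxModifications` (stmt-18506) — the OPEN
# CONTENT after the isolated regime landed (chain w42, 2026-08-26)

[OURS · L1 W4.2] The regime glue (`…Corridor3RegimeGlue.lean`, p457871) with its isolated-regime hypothesis
DISCHARGED by the landed registered stub `TameWild.stub_isolatedNu3` (p459425, from the named fact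
`CossartPiltant2019General`): kernel-checked, modulo the two printed theorems (CJS LNM 2270 Thm. 6.28 in
`ν`-form = `CossartJannsenSaito2020_nuElimination`; CP 2019 Thm. 1.1 = `CossartPiltant2019General`),

* `sigmaMaxModificationsCorridor3_of_tame_wild` — the child crux `SigmaMaxModificationsCorridor3` follows
  from the two remaining `ν`-wise regime statements of line `tame_wild`: `stub_tameNu3` (p-tame non-isolated
  maximal strata of threefolds over perfect fields; contains the un-citable step H4, order reduction of
  marked ideals in ambient dimension 3) and `stub_wildNu3` (the open core);
* `sigmaMaxModifications_of_tame_wild` — the parent crux `SigmaMaxModifications` follows from the same two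
  statements and the declared residual `DimGe4@base` (`Σ^max`-modifications at level `N = dim X ≥ 4`,
  stmt-19250).

NOT a statement of any manuscript. [cite: CossartJannsenSaito2020, Def. 6.14, Def. 6.15, Rem. 6.29]
[cite: CossartPiltant2019, Thm. 1.1]
-/

set_option linter.dupNamespace false -- mandated namespace of this single-conjunct summit

noncomputable section

open CategoryTheory AlgebraicGeometry TopologicalSpace Topology
open Literature.AlgebraicGeometry.Resolution Literature.RingTheory.HilbertSamuel
open Summit.ResolutionOfSingularities.ResolutionOfSingularities.Theses.HilbertSamuelElimination

namespace Summit.ResolutionOfSingularities.ResolutionOfSingularities.Theorems.SigmaMaxModificationsCorridor3.TameWild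

/-- **`SigmaMaxModificationsCorridor3` from the tame and wild regime statements** (isolated regime
discharged by `stub_isolatedNu3`, p459425), modulo the two printed facts.
[cite: CossartJannsenSaito2020, Def. 6.14, Def. 6.15, Thm. 6.28] [cite: CossartPiltant2019, Thm. 1.1] -/
theorem sigmaMaxModificationsCorridor3_of_tame_wild (hν : CossartJannsenSaito2020_nuElimination.{0})
    (hCP : CossartPiltant2019General.{0})
    (hTame : (∀ p : ℕ, p.Prime → ∀ (k : Type) [Field k] [CharP k p] [PerfectField k] (Y : Scheme.{0})
      (g : Y ⟶ Spec (.of k)), IsSeparated g → LocallyOfFiniteType g → QuasiCompact g →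
      IsReduced Y → ((3 : ℕ) : WithBot ℕ∞) ≤ topologicalKrullDim Y →
      topologicalKrullDim Y ≤ ((3 : ℕ) : WithBot ℕ∞) →
      ∀ ν : ℕ → ℕ, Maximal (· ∈ Scheme.hsValues Y 3) ν → ν ≠ iterPSum 3 Phi →
        IsTameValue p ν →
        ¬ Disjoint (closure ((Scheme.regularLocus Y)ᶜ \ Scheme.hsStratum Y 3 ν))
            (Scheme.hsStratum Y 3 ν) →
        NuMod Y 3 3 ν))
    (hWild : (∀ p : ℕ, p.Prime → ∀ (k : Type) [Field k] [CharP k p] (Y : Scheme.{0})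
      (g : Y ⟶ Spec (.of k)), IsSeparated g → LocallyOfFiniteType g → QuasiCompact g →
      IsReduced Y → ((3 : ℕ) : WithBot ℕ∞) ≤ topologicalKrullDim Y →
      topologicalKrullDim Y ≤ ((3 : ℕ) : WithBot ℕ∞) →
      ∀ ν : ℕ → ℕ, Maximal (· ∈ Scheme.hsValues Y 3) ν → ν ≠ iterPSum 3 Phi →
        ¬ (PerfectField k ∧ IsTameValue p ν) →
        ¬ Disjoint (closure ((Scheme.regularLocus Y)ᶜ \ Scheme.hsStratum Y 3 ν))
            (Scheme.hsStratum Y 3 ν) →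
        NuMod Y 3 3 ν)) :
    SigmaMaxModificationsCorridor3 :=
  sigmaMaxModificationsCorridor3_of_regimes hν hCP stub_isolatedNu3 hTame hWild

/-- **`SigmaMaxModifications` from the tame and wild regime statements and the residual `DimGe4@base`**,
modulo the two printed facts. [cite: CossartJannsenSaito2020, Def. 6.15, Cor. 6.18, Rem. 6.29]
[cite: CossartPiltant2019, Thm. 1.1] -/
theorem sigmaMaxModifications_of_tame_wild (hν : CossartJannsenSaito2020_nuElimination.{0})
    (hCP : CossartPiltant2019General.{0})
    (hTame : (∀ p : ℕ, p.Prime → ∀ (k : Type) [Field k] [CharP k p] [PerfectField k] (Y : Scheme.{0})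
      (g : Y ⟶ Spec (.of k)), IsSeparated g → LocallyOfFiniteType g → QuasiCompact g →
      IsReduced Y → ((3 : ℕ) : WithBot ℕ∞) ≤ topologicalKrullDim Y →
      topologicalKrullDim Y ≤ ((3 : ℕ) : WithBot ℕ∞) →
      ∀ ν : ℕ → ℕ, Maximal (· ∈ Scheme.hsValues Y 3) ν → ν ≠ iterPSum 3 Phi →
        IsTameValue p ν →
        ¬ Disjoint (closure ((Scheme.regularLocus Y)ᶜ \ Scheme.hsStratum Y 3 ν))
            (Scheme.hsStratum Y 3 ν) →
        NuMod Y 3 3 ν))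
    (hWild : (∀ p : ℕ, p.Prime → ∀ (k : Type) [Field k] [CharP k p] (Y : Scheme.{0})
      (g : Y ⟶ Spec (.of k)), IsSeparated g → LocallyOfFiniteType g → QuasiCompact g →
      IsReduced Y → ((3 : ℕ) : WithBot ℕ∞) ≤ topologicalKrullDim Y →
      topologicalKrullDim Y ≤ ((3 : ℕ) : WithBot ℕ∞) →
      ∀ ν : ℕ → ℕ, Maximal (· ∈ Scheme.hsValues Y 3) ν → ν ≠ iterPSum 3 Phi →
        ¬ (PerfectField k ∧ IsTameValue p ν) →
        ¬ Disjoint (closure ((Scheme.regularLocus Y)ᶜ \ Scheme.hsStratum Y 3 ν))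
            (Scheme.hsStratum Y 3 ν) →
        NuMod Y 3 3 ν))
    (hge4 : (∀ p : ℕ, p.Prime → ∀ (k : Type) [Field k] [CharP k p] (X : Scheme.{0})
      (f : X ⟶ Spec (.of k)), IsSeparated f → LocallyOfFiniteType f → QuasiCompact f →
      IsReduced X → ¬ Scheme.IsRegular X → ∀ N : ℕ, 4 ≤ N →
      (N : WithBot ℕ∞) ≤ topologicalKrullDim X → topologicalKrullDim X ≤ (N : WithBot ℕ∞) →
        ∃ (X' : Scheme.{0}) (π : X' ⟶ X), IsProper π ∧ IsReduced X' ∧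
          topologicalKrullDim X' ≤ ((N : ℕ) : WithBot ℕ∞) ∧
          (∀ U : X.Opens, (U : Set X) ⊆ (Scheme.hsMaxLocus X N)ᶜ → IsIso (π ∣_ U)) ∧
          Dense ((fun x' => π.base x') ⁻¹' (Scheme.hsMaxLocus X N)ᶜ) ∧
          (∀ x' : X', Scheme.hsFun X' N x' ≤ Scheme.hsFun X N (π.base x')) ∧
          ∀ ν : ℕ → ℕ, Maximal (· ∈ Scheme.hsValues X N) ν → ν ∉ Scheme.hsValues X' N)) :
    SigmaMaxModifications :=
  sigmaMaxModifications_of_regimes hν hCP stub_isolatedNu3 hTame hWild hge4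

end Summit.ResolutionOfSingularities.ResolutionOfSingularities.Theorems.SigmaMaxModificationsCorridor3.TameWild

end
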